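import Summits.KontsevichZagierPeriods.Zeta5Search.Certificates.RecordRayDenominatorsCellCore
import Summits.KontsevichZagierPeriods.Zeta5Search.Certificates.RecordRayDenominatorsExponent
import Summits.KontsevichZagierPeriods.Zeta5Search.AtlasCellRecG
import Summits.KontsevichZagierPeriods.Zeta5Search.AtlasCellRecH
import Summits.KontsevichZagierPeriods.Zeta5Search.AtlasCellRecI
import Summits.KontsevichZagierPeriods.Zeta5Search.AtlasCellRecJ
import Summits.KontsevichZagierPeriods.Zeta5Search.AtlasCellRecK
import Summits.KontsevichZagierPeriods.Zeta5Search.AtlasCellRecL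
import Summits.KontsevichZagierPeriods.Zeta5Search.AtlasCellRecM
import Summits.KontsevichZagierPeriods.Zeta5Search.RecordCellNProof
import Summits.KontsevichZagierPeriods.Zeta5Search.ZeroWindowM10
import Summits.KontsevichZagierPeriods.Zeta5Search.ZeroWindowM18
import Summits.KontsevichZagierPeriods.Zeta5Search.ZeroWindowM26
import Summits.KontsevichZagierPeriods.Zeta5Search.OriginWindowM12
import Summits.KontsevichZagierPeriods.Zeta5Search.OriginWindowM28
import HarnessLib

/-!
# ζ(5) search — the record ray's DENOMINATORS, VI: window tables and the first seven window lemmas (TYPER g15)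

HONEST FRAMING: systematic search; no irrationality claim unless certified.

OUR work (Summit side; typer seat, generation 15).  Eighteen window lemmas of one shape — for a prime `A·n < p ≤ B·n` (`n ≥ 42`), `p^k` divides the multiplied wedge `z_{W′}z_V − z_W z_{V′}` and the multiplied Q-minor `d⁵(z_U z_{W′} − z_{U′} z_W)`: the four big-prime windows of file IV (`winBig0–3`, exponents 8, 9, 10, 9) and fourteen CELL windows `winCell0–13` on `(17/9, 17/2]` from the landed record cells `RecordAtlas.RecordCellG/H/I/J/K/L/M/N`, `ResidueLaw.RecWindowM10/M12/M18/M26/M28` through `cell_core` (file V): on each, the twelve integer parts `⌊cn/p⌋` are pinned by the window (`Nat.div_eq_of_lt_le`), giving `v_p(N♯)`, `v_p(ρ)` and the exponent `k = min(9 + 2v_p(N♯) + B_cell, 9 + 2v_p(N♯) − v_p(ρ))` (values 4…9).  File VII assembles them (`multiWindowProd` over 18 windows, total rate `249.55`, exponent `0.537`).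
-/

noncomputable section

open Finset Real Filter Topology

namespace Summit.KontsevichZagierPeriods.Zeta5Search.RecordRay

open Summit.KontsevichZagierPeriods.Zeta5Search.DualSeries
open Summit.KontsevichZagierPeriods.Zeta5Search.DualSeriesDenominators
open Summit.KontsevichZagierPeriods.Zeta5Search.WedgeDictionary
open Summit.KontsevichZagierPeriods.Zeta5Search.DualSeriesLemma19 (bRecord)
open Summit.KontsevichZagierPeriods.Zeta5Search.CasoratianValuation (casoratian shift)
open Literature.NumberTheory.Irrationality.Hata1992
open Literature.NumberTheory.Transcendental (zetaValue)

/-- Left endpoints of the 18 windows, times `4680` (integers; window `i` is `(AZ i/4680 · n, BZ i/4680 · n]`). -/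
def AZ : Fin 18 → ℕ := ![74880, 79560, 84240, 117000, 8840, 9360, 14040, 18720, 19188, 21060, 21840, 23400, 25740, 26520, 28080, 29250, 37440, 38376]

/-- Right endpoints of the 18 windows, times `4680`. -/
def BZ : Fin 18 → ℕ := ![79560, 84240, 117000, 191880, 9000, 9750, 14625, 19188, 19890, 21840, 23400, 24960, 26520, 28080, 29250, 29640, 38376, 39780]

/-- Exponents removed on the 18 windows. -/
def wQ : Fin 18 → ℕ := ![8, 9, 10, 9, 6, 7, 7, 9, 8, 7, 4, 5, 9, 9, 9, 8, 7, 6]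

/-- Left endpoints as reals. -/
def AwinC (i : Fin 18) : ℝ := (AZ i : ℝ) / 4680

/-- Right endpoints as reals. -/
def BwinC (i : Fin 18) : ℝ := (BZ i : ℝ) / 4680

/-- A prime above `n ≥ 1` and above `b₁ > 0` cannot sit on the rational endpoint: `b₂·p ≤ b₁·n` forces `b₂·p < b₁·n`. -/
theorem lt_mul_of_prime {p n b₁ b₂ : ℕ} (hp : p.Prime) (hnp : n < p) (hb : b₁ < p) (hb0 : 0 < b₁) (hn : 1 ≤ n)
    (h : b₂ * p ≤ b₁ * n) : b₂ * p < b₁ * n := by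
  rcases h.lt_or_eq with h' | h'
  · exact h'
  · exfalso
    have hdvd : p ∣ b₁ * n := ⟨b₂, by rw [← h']; ring⟩
    rcases (Nat.Prime.dvd_mul hp).1 hdvd with h1 | h1
    · exact absurd (Nat.le_of_dvd hb0 h1) (by omega)
    · exact absurd (Nat.le_of_dvd (by omega) h1) (by omega)

section Windows

variable {n p : ℕ}

/-- Big-prime window `(16n, 17n]`, exponent `8` (files III/IV). -/
theorem winBig0 {n p : ℕ} (hn : 42 ≤ n) (hp : p.Prime) (hlo : AwinC 0 * n < p) (hhi : (p : ℝ) ≤ BwinC 0 * n)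
    {zW zV zW' zV' zU zU' : ℤ}
    (hzW : dRec n ^ 3 * sharpNormaliser (bRecord n) * coeffW (bRecord n) = zW)
    (hzV : dRec n ^ 6 * sharpNormaliser (bRecord n) * coeffV (bRecord n) = zV)
    (hzW' : dRec n ^ 3 * sharpNormaliser (bRecord' n) * coeffW (bRecord' n) = zW')
    (hzV' : dRec n ^ 6 * sharpNormaliser (bRecord' n) * coeffV (bRecord' n) = zV')
    (hzU : dRec n * sharpNormaliser (bRecord n) * coeffU (bRecord n) = zU)
    (hzU' : dRec n * sharpNormaliser (bRecord' n) * coeffU (bRecord' n) = zU') :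
    (p : ℤ) ^ 8 ∣ (zW' * zV - zW * zV') ∧
    (p : ℤ) ^ 8 ∣ ((Nat.lcmUpto (41 * n) : ℤ) ^ 5 * (zU * zW') - (Nat.lcmUpto (41 * n) : ℤ) ^ 5 * (zU' * zW)) := by
  have hloN : 16 * n < p := by
    have h : ((AZ 0 : ℕ) : ℝ) / 4680 * n < p := hlo
    rw [show AZ 0 = 74880 by decide] at h
    have h' : ((16 : ℕ) : ℝ) * n < p := by push_cast at h ⊢; linarith
    exact_mod_cast h'
  have hhiN : p ≤ 17 * n := by
    have h : (p : ℝ) ≤ ((BZ 0 : ℕ) : ℝ) / 4680 * n := hhi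
    rw [show BZ 0 = 79560 by decide] at h
    have h' : (p : ℝ) ≤ ((17 : ℕ) : ℝ) * n := by push_cast at h ⊢; linarith
    exact_mod_cast h'
  have hk : kfun n p = 8 := by simp [kfun, hhiN]
  refine ⟨?_, ?_⟩
  · rw [← hk]
    exact dvd_sub (dvd_wedge_term (by omega) hp (by omega) (by omega) (Or.inr rfl) (Or.inl rfl) hzW' hzV)
      (dvd_wedge_term (by omega) hp (by omega) (by omega) (Or.inl rfl) (Or.inr rfl) hzW hzV')
  · rw [← hk]
    exact dvd_sub (dvd_q_term (by omega) hp (by omega) (by omega) (Or.inl rfl) (Or.inr rfl) hzU hzW')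
      (dvd_q_term (by omega) hp (by omega) (by omega) (Or.inr rfl) (Or.inl rfl) hzU' hzW)

/-- Big-prime window `(17n, 18n]`, exponent `9` (files III/IV). -/
theorem winBig1 {n p : ℕ} (hn : 42 ≤ n) (hp : p.Prime) (hlo : AwinC 1 * n < p) (hhi : (p : ℝ) ≤ BwinC 1 * n)
    {zW zV zW' zV' zU zU' : ℤ}
    (hzW : dRec n ^ 3 * sharpNormaliser (bRecord n) * coeffW (bRecord n) = zW)
    (hzV : dRec n ^ 6 * sharpNormaliser (bRecord n) * coeffV (bRecord n) = zV)
    (hzW' : dRec n ^ 3 * sharpNormaliser (bRecord' n) * coeffW (bRecord' n) = zW')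
    (hzV' : dRec n ^ 6 * sharpNormaliser (bRecord' n) * coeffV (bRecord' n) = zV')
    (hzU : dRec n * sharpNormaliser (bRecord n) * coeffU (bRecord n) = zU)
    (hzU' : dRec n * sharpNormaliser (bRecord' n) * coeffU (bRecord' n) = zU') :
    (p : ℤ) ^ 9 ∣ (zW' * zV - zW * zV') ∧
    (p : ℤ) ^ 9 ∣ ((Nat.lcmUpto (41 * n) : ℤ) ^ 5 * (zU * zW') - (Nat.lcmUpto (41 * n) : ℤ) ^ 5 * (zU' * zW)) := by
  have hloN : 17 * n < p := by
    have h : ((AZ 1 : ℕ) : ℝ) / 4680 * n < p := hlo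
    rw [show AZ 1 = 79560 by decide] at h
    have h' : ((17 : ℕ) : ℝ) * n < p := by push_cast at h ⊢; linarith
    exact_mod_cast h'
  have hhiN : p ≤ 18 * n := by
    have h : (p : ℝ) ≤ ((BZ 1 : ℕ) : ℝ) / 4680 * n := hhi
    rw [show BZ 1 = 84240 by decide] at h
    have h' : (p : ℝ) ≤ ((18 : ℕ) : ℝ) * n := by push_cast at h ⊢; linarith
    exact_mod_cast h'
  have hk : kfun n p = 9 := by simp [kfun, hhiN, show ¬ p ≤ 17 * n by omega]
  refine ⟨?_, ?_⟩
  · rw [← hk]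
    exact dvd_sub (dvd_wedge_term (by omega) hp (by omega) (by omega) (Or.inr rfl) (Or.inl rfl) hzW' hzV)
      (dvd_wedge_term (by omega) hp (by omega) (by omega) (Or.inl rfl) (Or.inr rfl) hzW hzV')
  · rw [← hk]
    exact dvd_sub (dvd_q_term (by omega) hp (by omega) (by omega) (Or.inl rfl) (Or.inr rfl) hzU hzW')
      (dvd_q_term (by omega) hp (by omega) (by omega) (Or.inr rfl) (Or.inl rfl) hzU' hzW)

/-- Big-prime window `(18n, 25n]`, exponent `10` (files III/IV). -/
theorem winBig2 {n p : ℕ} (hn : 42 ≤ n) (hp : p.Prime) (hlo : AwinC 2 * n < p) (hhi : (p : ℝ) ≤ BwinC 2 * n)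
    {zW zV zW' zV' zU zU' : ℤ}
    (hzW : dRec n ^ 3 * sharpNormaliser (bRecord n) * coeffW (bRecord n) = zW)
    (hzV : dRec n ^ 6 * sharpNormaliser (bRecord n) * coeffV (bRecord n) = zV)
    (hzW' : dRec n ^ 3 * sharpNormaliser (bRecord' n) * coeffW (bRecord' n) = zW')
    (hzV' : dRec n ^ 6 * sharpNormaliser (bRecord' n) * coeffV (bRecord' n) = zV')
    (hzU : dRec n * sharpNormaliser (bRecord n) * coeffU (bRecord n) = zU)
    (hzU' : dRec n * sharpNormaliser (bRecord' n) * coeffU (bRecord' n) = zU') :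
    (p : ℤ) ^ 10 ∣ (zW' * zV - zW * zV') ∧
    (p : ℤ) ^ 10 ∣ ((Nat.lcmUpto (41 * n) : ℤ) ^ 5 * (zU * zW') - (Nat.lcmUpto (41 * n) : ℤ) ^ 5 * (zU' * zW)) := by
  have hloN : 18 * n < p := by
    have h : ((AZ 2 : ℕ) : ℝ) / 4680 * n < p := hlo
    rw [show AZ 2 = 84240 by decide] at h
    have h' : ((18 : ℕ) : ℝ) * n < p := by push_cast at h ⊢; linarith
    exact_mod_cast h'
  have hhiN : p ≤ 25 * n := by
    have h : (p : ℝ) ≤ ((BZ 2 : ℕ) : ℝ) / 4680 * n := hhi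
    rw [show BZ 2 = 117000 by decide] at h
    have h' : (p : ℝ) ≤ ((25 : ℕ) : ℝ) * n := by push_cast at h ⊢; linarith
    exact_mod_cast h'
  have hk : kfun n p = 10 := by simp [kfun, hhiN, show ¬ p ≤ 17 * n by omega, show ¬ p ≤ 18 * n by omega]
  refine ⟨?_, ?_⟩
  · rw [← hk]
    exact dvd_sub (dvd_wedge_term (by omega) hp (by omega) (by omega) (Or.inr rfl) (Or.inl rfl) hzW' hzV)
      (dvd_wedge_term (by omega) hp (by omega) (by omega) (Or.inl rfl) (Or.inr rfl) hzW hzV')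
  · rw [← hk]
    exact dvd_sub (dvd_q_term (by omega) hp (by omega) (by omega) (Or.inl rfl) (Or.inr rfl) hzU hzW')
      (dvd_q_term (by omega) hp (by omega) (by omega) (Or.inr rfl) (Or.inl rfl) hzU' hzW)

/-- Big-prime window `(25n, 41n]`, exponent `9` (files III/IV). -/
theorem winBig3 {n p : ℕ} (hn : 42 ≤ n) (hp : p.Prime) (hlo : AwinC 3 * n < p) (hhi : (p : ℝ) ≤ BwinC 3 * n)
    {zW zV zW' zV' zU zU' : ℤ}
    (hzW : dRec n ^ 3 * sharpNormaliser (bRecord n) * coeffW (bRecord n) = zW)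
    (hzV : dRec n ^ 6 * sharpNormaliser (bRecord n) * coeffV (bRecord n) = zV)
    (hzW' : dRec n ^ 3 * sharpNormaliser (bRecord' n) * coeffW (bRecord' n) = zW')
    (hzV' : dRec n ^ 6 * sharpNormaliser (bRecord' n) * coeffV (bRecord' n) = zV')
    (hzU : dRec n * sharpNormaliser (bRecord n) * coeffU (bRecord n) = zU)
    (hzU' : dRec n * sharpNormaliser (bRecord' n) * coeffU (bRecord' n) = zU') :
    (p : ℤ) ^ 9 ∣ (zW' * zV - zW * zV') ∧
    (p : ℤ) ^ 9 ∣ ((Nat.lcmUpto (41 * n) : ℤ) ^ 5 * (zU * zW') - (Nat.lcmUpto (41 * n) : ℤ) ^ 5 * (zU' * zW)) := by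
  have hloN : 25 * n < p := by
    have h : ((AZ 3 : ℕ) : ℝ) / 4680 * n < p := hlo
    rw [show AZ 3 = 117000 by decide] at h
    have h' : ((25 : ℕ) : ℝ) * n < p := by push_cast at h ⊢; linarith
    exact_mod_cast h'
  have hhiN : p ≤ 41 * n := by
    have h : (p : ℝ) ≤ ((BZ 3 : ℕ) : ℝ) / 4680 * n := hhi
    rw [show BZ 3 = 191880 by decide] at h
    have h' : (p : ℝ) ≤ ((41 : ℕ) : ℝ) * n := by push_cast at h ⊢; linarith
    exact_mod_cast h'
  have hk : kfun n p = 9 := by simp [kfun, show ¬ p ≤ 17 * n by omega, show ¬ p ≤ 18 * n by omega, show ¬ p ≤ 25 * n by omega]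
  refine ⟨?_, ?_⟩
  · rw [← hk]
    exact dvd_sub (dvd_wedge_term (by omega) hp (by omega) (by omega) (Or.inr rfl) (Or.inl rfl) hzW' hzV)
      (dvd_wedge_term (by omega) hp (by omega) (by omega) (Or.inl rfl) (Or.inr rfl) hzW hzV')
  · rw [← hk]
    exact dvd_sub (dvd_q_term (by omega) hp (by omega) (by omega) (Or.inl rfl) (Or.inr rfl) hzU hzW')
      (dvd_q_term (by omega) hp (by omega) (by omega) (Or.inr rfl) (Or.inl rfl) hzU' hzW)

/-- Cell window `(17/9n, 25/13n]`: `OriginWindowM28.recWindowM28_holds` (`-51 ≤ v_p(Cas₇)`), `v_p(N♯) = 24`, `v_p(ρ) = 48`, exponent `6`. -/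
theorem winCell0 {n p : ℕ} (hn : 42 ≤ n) (hp : p.Prime) (hlo : AwinC 4 * n < p) (hhi : (p : ℝ) ≤ BwinC 4 * n)
    {zW zV zW' zV' zU zU' : ℤ}
    (hzW : dRec n ^ 3 * sharpNormaliser (bRecord n) * coeffW (bRecord n) = zW)
    (hzV : dRec n ^ 6 * sharpNormaliser (bRecord n) * coeffV (bRecord n) = zV)
    (hzW' : dRec n ^ 3 * sharpNormaliser (bRecord' n) * coeffW (bRecord' n) = zW')
    (hzV' : dRec n ^ 6 * sharpNormaliser (bRecord' n) * coeffV (bRecord' n) = zV')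
    (hzU : dRec n * sharpNormaliser (bRecord n) * coeffU (bRecord n) = zU)
    (hzU' : dRec n * sharpNormaliser (bRecord' n) * coeffU (bRecord' n) = zU') :
    (p : ℤ) ^ 6 ∣ (zW' * zV - zW * zV') ∧
    (p : ℤ) ^ 6 ∣ ((Nat.lcmUpto (41 * n) : ℤ) ^ 5 * (zU * zW') - (Nat.lcmUpto (41 * n) : ℤ) ^ 5 * (zU' * zW)) := by
  have hloN : 17 * n < 9 * p := by
    have h : ((AZ 4 : ℕ) : ℝ) / 4680 * n < p := hlo
    rw [show AZ 4 = 8840 by decide] at h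
    have h' : ((17 : ℕ) : ℝ) * n < ((9 : ℕ) : ℝ) * p := by push_cast at h ⊢; linarith
    exact_mod_cast h'
  have hhiN : 13 * p ≤ 25 * n := by
    have h : (p : ℝ) ≤ ((BZ 4 : ℕ) : ℝ) / 4680 * n := hhi
    rw [show BZ 4 = 9000 by decide] at h
    have h' : ((13 : ℕ) : ℝ) * p ≤ ((25 : ℕ) : ℝ) * n := by push_cast at h ⊢; linarith
    exact_mod_cast h'
  have hhiN' : 13 * p ≤ 25 * n := hhiN
  have hn1 : 1 ≤ n := by omega
  have hnp : n < p := by omega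
  have hp41 : p ≤ 41 * n := by omega
  have hsq : 41 * n < p ^ 2 := by nlinarith
  have e8 : 8 * n / p = 4 := Nat.div_eq_of_lt_le (by omega) (by omega)
  have e9 : 9 * n / p = 4 := Nat.div_eq_of_lt_le (by omega) (by omega)
  have e10 : 10 * n / p = 5 := Nat.div_eq_of_lt_le (by omega) (by omega)
  have e11 : 11 * n / p = 5 := Nat.div_eq_of_lt_le (by omega) (by omega)
  have e12 : 12 * n / p = 6 := Nat.div_eq_of_lt_le (by omega) (by omega)
  have e13 : 13 * n / p = 6 := Nat.div_eq_of_lt_le (by omega) (by omega)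
  have e14 : 14 * n / p = 7 := Nat.div_eq_of_lt_le (by omega) (by omega)
  have e15 : 15 * n / p = 7 := Nat.div_eq_of_lt_le (by omega) (by omega)
  have e16 : 16 * n / p = 8 := Nat.div_eq_of_lt_le (by omega) (by omega)
  have e17 : 17 * n / p = 8 := Nat.div_eq_of_lt_le (by omega) (by omega)
  have e18 : 18 * n / p = 9 := Nat.div_eq_of_lt_le (by omega) (by omega)
  have e25 : 25 * n / p = 13 := Nat.div_eq_of_lt_le (by omega) (by omega)
  have hvN : padicValRat p (sharpNormaliser (bRecord n)) = 24 := by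
    rw [padicValRat_sharpNormaliser_bRecord hp (by omega), e12, e13, e14, e15, e16]; norm_num
  have hvN' : padicValRat p (sharpNormaliser (bRecord' n)) = 24 := by
    rw [padicValRat_sharpNormaliser_bRecord' hn1 hp hnp (by omega) (by omega), e12, e13, e14, e15, e16]; norm_num
  have hvr : padicValRat p (rhoOf (aRec n)) = 48 := by
    rw [padicValRat_rhoOf_aRec hp (by omega) (by omega), e8, e9, e10, e11, e12, e13, e14, e15, e16, e17, e18, e25]
    norm_num
  have hcas : casoratian (bRecord n) 7 ≠ 0 → (-51 : ℤ) ≤ padicValRat p (casoratian (bRecord n) 7) := by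
    intro hne
    rw [bRecord_eq_bRec] at hne ⊢
    exact OriginWindowM28.recWindowM28_holds n p (by omega) hp (by omega) (by have := lt_mul_of_prime hp hnp (show 25 < p by omega) (by norm_num) hn1 hhiN'; omega) (by nlinarith) hne
  exact cell_core hn1 hp hp41 hsq hvN hvN' hvr hcas (k := 6) (by norm_num) (by norm_num) hzW hzV hzW' hzV' hzU hzU'

/-- Cell window `(2n, 25/12n]`: `ZeroWindowM26.recWindowM26_holds` (`-46 ≤ v_p(Cas₇)`), `v_p(N♯) = 22`, `v_p(ρ) = 42`, exponent `7`. -/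
theorem winCell1 {n p : ℕ} (hn : 42 ≤ n) (hp : p.Prime) (hlo : AwinC 5 * n < p) (hhi : (p : ℝ) ≤ BwinC 5 * n)
    {zW zV zW' zV' zU zU' : ℤ}
    (hzW : dRec n ^ 3 * sharpNormaliser (bRecord n) * coeffW (bRecord n) = zW)
    (hzV : dRec n ^ 6 * sharpNormaliser (bRecord n) * coeffV (bRecord n) = zV)
    (hzW' : dRec n ^ 3 * sharpNormaliser (bRecord' n) * coeffW (bRecord' n) = zW')
    (hzV' : dRec n ^ 6 * sharpNormaliser (bRecord' n) * coeffV (bRecord' n) = zV')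
    (hzU : dRec n * sharpNormaliser (bRecord n) * coeffU (bRecord n) = zU)
    (hzU' : dRec n * sharpNormaliser (bRecord' n) * coeffU (bRecord' n) = zU') :
    (p : ℤ) ^ 7 ∣ (zW' * zV - zW * zV') ∧
    (p : ℤ) ^ 7 ∣ ((Nat.lcmUpto (41 * n) : ℤ) ^ 5 * (zU * zW') - (Nat.lcmUpto (41 * n) : ℤ) ^ 5 * (zU' * zW)) := by
  have hloN : 2 * n < 1 * p := by
    have h : ((AZ 5 : ℕ) : ℝ) / 4680 * n < p := hlo
    rw [show AZ 5 = 9360 by decide] at h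
    have h' : ((2 : ℕ) : ℝ) * n < ((1 : ℕ) : ℝ) * p := by push_cast at h ⊢; linarith
    exact_mod_cast h'
  have hhiN : 12 * p ≤ 25 * n := by
    have h : (p : ℝ) ≤ ((BZ 5 : ℕ) : ℝ) / 4680 * n := hhi
    rw [show BZ 5 = 9750 by decide] at h
    have h' : ((12 : ℕ) : ℝ) * p ≤ ((25 : ℕ) : ℝ) * n := by push_cast at h ⊢; linarith
    exact_mod_cast h'
  have hhiN' : 12 * p ≤ 25 * n := hhiN
  have hn1 : 1 ≤ n := by omega
  have hnp : n < p := by omega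
  have hp41 : p ≤ 41 * n := by omega
  have hsq : 41 * n < p ^ 2 := by nlinarith
  have e8 : 8 * n / p = 3 := Nat.div_eq_of_lt_le (by omega) (by omega)
  have e9 : 9 * n / p = 4 := Nat.div_eq_of_lt_le (by omega) (by omega)
  have e10 : 10 * n / p = 4 := Nat.div_eq_of_lt_le (by omega) (by omega)
  have e11 : 11 * n / p = 5 := Nat.div_eq_of_lt_le (by omega) (by omega)
  have e12 : 12 * n / p = 5 := Nat.div_eq_of_lt_le (by omega) (by omega)
  have e13 : 13 * n / p = 6 := Nat.div_eq_of_lt_le (by omega) (by omega)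
  have e14 : 14 * n / p = 6 := Nat.div_eq_of_lt_le (by omega) (by omega)
  have e15 : 15 * n / p = 7 := Nat.div_eq_of_lt_le (by omega) (by omega)
  have e16 : 16 * n / p = 7 := Nat.div_eq_of_lt_le (by omega) (by omega)
  have e17 : 17 * n / p = 8 := Nat.div_eq_of_lt_le (by omega) (by omega)
  have e18 : 18 * n / p = 8 := Nat.div_eq_of_lt_le (by omega) (by omega)
  have e25 : 25 * n / p = 12 := Nat.div_eq_of_lt_le (by omega) (by omega)
  have hvN : padicValRat p (sharpNormaliser (bRecord n)) = 22 := by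
    rw [padicValRat_sharpNormaliser_bRecord hp (by omega), e12, e13, e14, e15, e16]; norm_num
  have hvN' : padicValRat p (sharpNormaliser (bRecord' n)) = 22 := by
    rw [padicValRat_sharpNormaliser_bRecord' hn1 hp hnp (by omega) (by omega), e12, e13, e14, e15, e16]; norm_num
  have hvr : padicValRat p (rhoOf (aRec n)) = 42 := by
    rw [padicValRat_rhoOf_aRec hp (by omega) (by omega), e8, e9, e10, e11, e12, e13, e14, e15, e16, e17, e18, e25]
    norm_num
  have hcas : casoratian (bRecord n) 7 ≠ 0 → (-46 : ℤ) ≤ padicValRat p (casoratian (bRecord n) 7) := by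
    intro hne
    rw [bRecord_eq_bRec] at hne ⊢
    exact ZeroWindowM26.recWindowM26_holds n p (by omega) hp (by omega) (by have := lt_mul_of_prime hp hnp (show 25 < p by omega) (by norm_num) hn1 hhiN'; omega) hne
  exact cell_core hn1 hp hp41 hsq hvN hvN' hvr hcas (k := 7) (by norm_num) (by norm_num) hzW hzV hzW' hzV' hzU hzU'

/-- Cell window `(3n, 25/8n]`: `ZeroWindowM18.recWindowM18_holds` (`-30 ≤ v_p(Cas₇)`), `v_p(N♯) = 14`, `v_p(ρ) = 27`, exponent `7`. -/
theorem winCell2 {n p : ℕ} (hn : 42 ≤ n) (hp : p.Prime) (hlo : AwinC 6 * n < p) (hhi : (p : ℝ) ≤ BwinC 6 * n)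
    {zW zV zW' zV' zU zU' : ℤ}
    (hzW : dRec n ^ 3 * sharpNormaliser (bRecord n) * coeffW (bRecord n) = zW)
    (hzV : dRec n ^ 6 * sharpNormaliser (bRecord n) * coeffV (bRecord n) = zV)
    (hzW' : dRec n ^ 3 * sharpNormaliser (bRecord' n) * coeffW (bRecord' n) = zW')
    (hzV' : dRec n ^ 6 * sharpNormaliser (bRecord' n) * coeffV (bRecord' n) = zV')
    (hzU : dRec n * sharpNormaliser (bRecord n) * coeffU (bRecord n) = zU)
    (hzU' : dRec n * sharpNormaliser (bRecord' n) * coeffU (bRecord' n) = zU') :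
    (p : ℤ) ^ 7 ∣ (zW' * zV - zW * zV') ∧
    (p : ℤ) ^ 7 ∣ ((Nat.lcmUpto (41 * n) : ℤ) ^ 5 * (zU * zW') - (Nat.lcmUpto (41 * n) : ℤ) ^ 5 * (zU' * zW)) := by
  have hloN : 3 * n < 1 * p := by
    have h : ((AZ 6 : ℕ) : ℝ) / 4680 * n < p := hlo
    rw [show AZ 6 = 14040 by decide] at h
    have h' : ((3 : ℕ) : ℝ) * n < ((1 : ℕ) : ℝ) * p := by push_cast at h ⊢; linarith
    exact_mod_cast h'
  have hhiN : 8 * p ≤ 25 * n := by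
    have h : (p : ℝ) ≤ ((BZ 6 : ℕ) : ℝ) / 4680 * n := hhi
    rw [show BZ 6 = 14625 by decide] at h
    have h' : ((8 : ℕ) : ℝ) * p ≤ ((25 : ℕ) : ℝ) * n := by push_cast at h ⊢; linarith
    exact_mod_cast h'
  have hhiN' : 8 * p ≤ 25 * n := hhiN
  have hn1 : 1 ≤ n := by omega
  have hnp : n < p := by omega
  have hp41 : p ≤ 41 * n := by omega
  have hsq : 41 * n < p ^ 2 := by nlinarith
  have e8 : 8 * n / p = 2 := Nat.div_eq_of_lt_le (by omega) (by omega)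
  have e9 : 9 * n / p = 2 := Nat.div_eq_of_lt_le (by omega) (by omega)
  have e10 : 10 * n / p = 3 := Nat.div_eq_of_lt_le (by omega) (by omega)
  have e11 : 11 * n / p = 3 := Nat.div_eq_of_lt_le (by omega) (by omega)
  have e12 : 12 * n / p = 3 := Nat.div_eq_of_lt_le (by omega) (by omega)
  have e13 : 13 * n / p = 4 := Nat.div_eq_of_lt_le (by omega) (by omega)
  have e14 : 14 * n / p = 4 := Nat.div_eq_of_lt_le (by omega) (by omega)
  have e15 : 15 * n / p = 4 := Nat.div_eq_of_lt_le (by omega) (by omega)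
  have e16 : 16 * n / p = 5 := Nat.div_eq_of_lt_le (by omega) (by omega)
  have e17 : 17 * n / p = 5 := Nat.div_eq_of_lt_le (by omega) (by omega)
  have e18 : 18 * n / p = 5 := Nat.div_eq_of_lt_le (by omega) (by omega)
  have e25 : 25 * n / p = 8 := Nat.div_eq_of_lt_le (by omega) (by omega)
  have hvN : padicValRat p (sharpNormaliser (bRecord n)) = 14 := by
    rw [padicValRat_sharpNormaliser_bRecord hp (by omega), e12, e13, e14, e15, e16]; norm_num
  have hvN' : padicValRat p (sharpNormaliser (bRecord' n)) = 14 := by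
    rw [padicValRat_sharpNormaliser_bRecord' hn1 hp hnp (by omega) (by omega), e12, e13, e14, e15, e16]; norm_num
  have hvr : padicValRat p (rhoOf (aRec n)) = 27 := by
    rw [padicValRat_rhoOf_aRec hp (by omega) (by omega), e8, e9, e10, e11, e12, e13, e14, e15, e16, e17, e18, e25]
    norm_num
  have hcas : casoratian (bRecord n) 7 ≠ 0 → (-30 : ℤ) ≤ padicValRat p (casoratian (bRecord n) 7) := by
    intro hne
    rw [bRecord_eq_bRec] at hne ⊢
    exact ZeroWindowM18.recWindowM18_holds n p (by omega) hp (by omega) (by have := lt_mul_of_prime hp hnp (show 25 < p by omega) (by norm_num) hn1 hhiN'; omega) hne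
  exact cell_core hn1 hp hp41 hsq hvN hvN' hvr hcas (k := 7) (by norm_num) (by norm_num) hzW hzV hzW' hzV' hzU hzU'

end Windows

end Summit.KontsevichZagierPeriods.Zeta5Search.RecordRay
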